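import Mathlib

/-!
# Hall-violation count for splice instances — stub `stub_hallCount` of line `Sketch`,
# crux stmt-PneNP-2463 (`SolvableImpliesStableSection`)

Random `k`-SAT in the with-replacement literal model: an instance is
`Φ : Fin m → Fin k → Fin n × Bool` (`m` clauses of `k` literal slots, literal = (variable, sign));
a path tuple is `Ψ : Fin (k+1) → (instances)` and the splice instance at `(r, q)` takes the slots
at positions `i*k+j < q` from `Ψ r.succ` and the others from `Ψ r.castSucc`.
We bound the number of path tuples whose splice instance VIOLATES Hall's condition (some set `T`
of clauses involves `< #T` distinct variables) by the first moment
`#Paths · Σ_{c=2}^{m} C(m,c)·C(n,c-1)·((c-1)/n)^{kc}`: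
* `hc_card_filter_splice`: the splice map is measure preserving (a swap involution of the path
  tuples carries it to the coordinate projection `Ψ ↦ Ψ r.castSucc`), and `hc_card_filter_apply`
  counts a coordinate condition on a product;
* `hc_card_bad_le`: for one uniform instance, a violating `T` of size `c ≥ 2` has all its `kc`
  variable slots inside a `(c-1)`-set of variables (`hc_bad_witness`), and for fixed `T`, `V` there
  are exactly `(2(c-1))^{kc} (2n)^{k(m-c)}` such instances (`hc_card_confined`); union bound.
Used by the low-density assembly of the line (satisfiability of every splice instance).
-/

set_option linter.dupNamespace false

namespace Summit.PneNP.PneNP.Cruxes.SolvableImpliesStableSection.Sketch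

open Finset
open scoped Classical

/-- Counting a condition on one coordinate of a function space:
`#{f : ι → α | Q (f i₀)} = #{a | Q a} · (#α)^(#ι - 1)`. -/
private theorem hc_card_filter_apply {ι α : Type*} [Fintype ι] [DecidableEq ι] [Fintype α]
    (i₀ : ι) (Q : α → Prop) [DecidablePred Q] :
    ((univ : Finset (ι → α)).filter fun f => Q (f i₀)).card
      = (univ.filter Q).card * Fintype.card α ^ (Fintype.card ι - 1) := by
  have h : ((univ : Finset (ι → α)).filter fun f => Q (f i₀))
      = Fintype.piFinset fun i => if i = i₀ then univ.filter Q else univ := by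
    ext f
    simp only [mem_filter, mem_univ, true_and, Fintype.mem_piFinset]
    constructor
    · intro hf i
      split_ifs with hi
      · subst hi; simpa using hf
      · exact mem_univ _
    · intro hf
      simpa using hf i₀
  rw [h, Fintype.card_piFinset, ← Finset.mul_prod_erase univ _ (mem_univ i₀),
    if_pos (rfl : i₀ = i₀)]
  have hrest : ∀ i ∈ univ.erase i₀,
      (if i = i₀ then univ.filter Q else (univ : Finset α)).card = Fintype.card α := by
    intro i hi
    rw [if_neg (ne_of_mem_erase hi), card_univ]
  rw [prod_congr rfl hrest, prod_const, card_erase_of_mem (mem_univ _), card_univ]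

/-- Uniformity of the splice instance: the swap involution exchanging, at the positions
`i*k+j < q`, the coordinates `r.castSucc` and `r.succ` of a path tuple carries the splice map to
the projection `Ψ ↦ Ψ r.castSucc`; hence both pull back any event `Q` to sets of equal size. -/
private theorem hc_card_filter_splice (k m n : ℕ) (r : Fin k) (q : ℕ)
    (Q : (Fin m → Fin k → Fin n × Bool) → Prop) [DecidablePred Q] :
    ((univ : Finset (Fin (k + 1) → Fin m → Fin k → Fin n × Bool)).filter fun Ψ =>
        Q fun i j => if (i : ℕ) * k + j < q then Ψ r.succ i j else Ψ r.castSucc i j).card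
      = ((univ : Finset (Fin (k + 1) → Fin m → Fin k → Fin n × Bool)).filter fun Ψ =>
          Q (Ψ r.castSucc)).card := by
  have hne : r.succ ≠ r.castSucc := Fin.castSucc_lt_succ.ne'
  refine Finset.card_bijective
    (fun (Ψ : Fin (k + 1) → Fin m → Fin k → Fin n × Bool) (ρ : Fin (k + 1)) (i : Fin m)
        (j : Fin k) =>
      if (i : ℕ) * k + j < q then
        (if ρ = r.castSucc then Ψ r.succ i j else if ρ = r.succ then Ψ r.castSucc i j else Ψ ρ i j)
      else Ψ ρ i j)
    (Function.Involutive.bijective ?_) ?_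
  · intro Ψ
    funext ρ i j
    by_cases h1 : (i : ℕ) * k + j < q
    · by_cases h2 : ρ = r.castSucc
      · subst h2
        simp [h1, hne]
      · by_cases h3 : ρ = r.succ
        · subst h3
          simp [h1, hne]
        · simp [h1, h2, h3]
    · simp [h1]
  · intro Ψ
    simp only [mem_filter, mem_univ, true_and]
    simp

/-- A Hall violator yields a confinement witness: if the clauses of `T` involve `< #T` variables,
then `c := #T ∈ [2, m]` and all `k·c` variable slots of the clauses in `T` lie in some set `V`
of exactly `c - 1` variables. -/
private theorem hc_bad_witness (k m n : ℕ) (hk : 1 ≤ k) (hmn : m ≤ n)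
    (Φ : Fin m → Fin k → Fin n × Bool) (T : Finset (Fin m))
    (hT : (T.biUnion fun i => univ.image fun j : Fin k => (Φ i j).1).card < T.card) :
    ∃ c ∈ Icc 2 m, ∃ S ∈ powersetCard c (univ : Finset (Fin m)),
      ∃ V ∈ powersetCard (c - 1) (univ : Finset (Fin n)), ∀ i ∈ S, ∀ j, (Φ i j).1 ∈ V := by
  set N := T.biUnion fun i => univ.image fun j : Fin k => (Φ i j).1
  have hTne : T.Nonempty := by
    rw [Finset.nonempty_iff_ne_empty]
    rintro rfl
    simp at hT
  obtain ⟨i₀, hi₀⟩ := hTne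
  have hsub : ∀ i ∈ T, ∀ j, (Φ i j).1 ∈ N := fun i hi j =>
    Finset.mem_biUnion.mpr ⟨i, hi, Finset.mem_image.mpr ⟨j, mem_univ _, rfl⟩⟩
  have hNpos : 0 < N.card := Finset.card_pos.mpr ⟨_, hsub i₀ hi₀ ⟨0, hk⟩⟩
  have hTm : T.card ≤ m := (card_le_univ T).trans_eq (Fintype.card_fin m)
  obtain ⟨V, hNV, hVcard⟩ := Finset.exists_superset_card_eq (s := N) (n := T.card - 1)
    (by omega) (by rw [Fintype.card_fin]; omega)
  exact ⟨T.card, Finset.mem_Icc.mpr ⟨by omega, hTm⟩, T,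
    Finset.mem_powersetCard.mpr ⟨subset_univ _, rfl⟩, V,
    Finset.mem_powersetCard.mpr ⟨subset_univ _, hVcard⟩, fun i hi j => hNV (hsub i hi j)⟩

/-- Instances whose clauses in `S` (`#S = c`) only use variables from `V` (`#V = e`):
exactly `(2e)^{kc} · (2n)^{k(m-c)}` of them (a product set). -/
private theorem hc_card_confined (k m n c e : ℕ) (S : Finset (Fin m)) (hS : S.card = c)
    (V : Finset (Fin n)) (hV : V.card = e) :
    ((univ : Finset (Fin m → Fin k → Fin n × Bool)).filter fun Φ =>
        ∀ i ∈ S, ∀ j, (Φ i j).1 ∈ V).card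
      = (2 * e) ^ (k * c) * (2 * n) ^ (k * (m - c)) := by
  have h : ((univ : Finset (Fin m → Fin k → Fin n × Bool)).filter fun Φ =>
        ∀ i ∈ S, ∀ j, (Φ i j).1 ∈ V)
      = Fintype.piFinset fun i => if i ∈ S then
          Fintype.piFinset fun _ : Fin k => V ×ˢ (univ : Finset Bool) else univ := by
    ext Φ
    simp only [mem_filter, mem_univ, true_and, Fintype.mem_piFinset]
    constructor
    · intro hΦ i
      split_ifs with hi
      · exact Fintype.mem_piFinset.mpr fun j => mem_product.mpr ⟨hΦ i hi j, mem_univ _⟩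
      · exact mem_univ _
    · intro hΦ i hi j
      have := hΦ i
      rw [if_pos hi, Fintype.mem_piFinset] at this
      exact (mem_product.mp (this j)).1
  have hA : (Fintype.piFinset fun _ : Fin k => V ×ˢ (univ : Finset Bool)).card = (2 * e) ^ k := by
    rw [Fintype.card_piFinset_const, card_product, card_univ, Fintype.card_bool, hV, mul_comm]
  have hU : (univ : Finset (Fin k → Fin n × Bool)).card = (2 * n) ^ k := by
    simp only [card_univ, Fintype.card_fun, Fintype.card_prod, Fintype.card_fin, Fintype.card_bool]
    rw [mul_comm]
  have hterm : ∀ i : Fin m, (if i ∈ S then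
      (Fintype.piFinset fun _ : Fin k => V ×ˢ (univ : Finset Bool)) else univ).card
        = if i ∈ S then (2 * e) ^ k else (2 * n) ^ k := by
    intro i
    split_ifs
    exacts [hA, hU]
  rw [h, Fintype.card_piFinset]
  simp_rw [hterm]
  rw [prod_ite, prod_const, prod_const, filter_mem_eq_inter, univ_inter, filter_not,
    filter_mem_eq_inter, univ_inter, card_univ_sdiff, Fintype.card_fin, hS, ← pow_mul, ← pow_mul]

/-- First moment for ONE uniform instance: the number of instances violating Hall's condition is
at most `Σ_{c=2}^{m} C(m,c) · C(n,c-1) · (2(c-1))^{kc} (2n)^{k(m-c)}` (union bound over the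
witnesses of `hc_bad_witness`, each counted by `hc_card_confined`). -/
private theorem hc_card_bad_le (k m n : ℕ) (hk : 1 ≤ k) (hmn : m ≤ n) :
    ((univ : Finset (Fin m → Fin k → Fin n × Bool)).filter fun Φ => ∃ T : Finset (Fin m),
        (T.biUnion fun i => univ.image fun j : Fin k => (Φ i j).1).card < T.card).card
      ≤ ∑ c ∈ Icc 2 m, m.choose c * n.choose (c - 1) *
          ((2 * (c - 1)) ^ (k * c) * (2 * n) ^ (k * (m - c))) := by
  have hcover : ((univ : Finset (Fin m → Fin k → Fin n × Bool)).filter fun Φ =>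
        ∃ T : Finset (Fin m),
          (T.biUnion fun i => univ.image fun j : Fin k => (Φ i j).1).card < T.card)
      ⊆ (Icc 2 m).biUnion fun c => (powersetCard c (univ : Finset (Fin m))).biUnion fun S =>
          (powersetCard (c - 1) (univ : Finset (Fin n))).biUnion fun V =>
            univ.filter fun Φ : Fin m → Fin k → Fin n × Bool => ∀ i ∈ S, ∀ j, (Φ i j).1 ∈ V := by
    intro Φ hΦ
    obtain ⟨T, hT⟩ := (mem_filter.mp hΦ).2
    obtain ⟨c, hc, S, hS, V, hV, hconf⟩ := hc_bad_witness k m n hk hmn Φ T hT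
    simp only [mem_biUnion, mem_filter, mem_univ, true_and]
    exact ⟨c, hc, S, hS, V, hV, hconf⟩
  refine (card_le_card hcover).trans (card_biUnion_le.trans (sum_le_sum fun c _ => ?_))
  calc _ ≤ ∑ S ∈ powersetCard c (univ : Finset (Fin m)),
          ∑ V ∈ powersetCard (c - 1) (univ : Finset (Fin n)),
            (2 * (c - 1)) ^ (k * c) * (2 * n) ^ (k * (m - c)) :=
        card_biUnion_le.trans (sum_le_sum fun S hS => card_biUnion_le.trans
          (sum_le_sum fun V hV => (hc_card_confined k m n c (c - 1) S (mem_powersetCard.mp hS).2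
            V (mem_powersetCard.mp hV).2).le))
    _ = _ := by
        rw [sum_const, sum_const, smul_eq_mul, smul_eq_mul, card_powersetCard, card_powersetCard,
          card_univ, card_univ, Fintype.card_fin, Fintype.card_fin]
        ring

/-- **Hall-violation count along the path.** The number of path tuples `Ψ` whose splice instance
at `(r, q)` violates Hall's condition is at most
`#Paths · Σ_{c=2}^{m} C(m,c) · C(n,c-1) · ((c-1)/n)^{kc}`.
Proof: the splice instance is uniformly distributed (`hc_card_filter_splice`,
`hc_card_filter_apply`), and one uniform instance is handled by `hc_card_bad_le`; finally
`(2(c-1))^{kc} (2n)^{k(m-c)} = #Inst · ((c-1)/n)^{kc}` in `ℝ`. -/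
theorem stub_hallCount (k m n : ℕ) (hk : 1 ≤ k) (hn : 1 ≤ n) (hmn : m ≤ n) (r : Fin k) (q : ℕ) :
    (((Finset.univ : Finset (Fin (k + 1) → Fin m → Fin k → Fin n × Bool)).filter fun Ψ =>
        ∃ T : Finset (Fin m),
          (T.biUnion fun i => Finset.univ.image fun j : Fin k =>
            (if (i : ℕ) * k + j < q then Ψ r.succ i j else Ψ r.castSucc i j).1).card < T.card).card : ℝ)
      ≤ (Fintype.card (Fin (k + 1) → Fin m → Fin k → Fin n × Bool) : ℝ) *
        ∑ c ∈ Finset.Icc 2 m, ((m.choose c : ℕ) : ℝ) * ((n.choose (c - 1) : ℕ) : ℝ) *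
          (((c - 1 : ℕ) : ℝ) / n) ^ (k * c) := by
  have h1 : ((Finset.univ : Finset (Fin (k + 1) → Fin m → Fin k → Fin n × Bool)).filter fun Ψ =>
        ∃ T : Finset (Fin m),
          (T.biUnion fun i => Finset.univ.image fun j : Fin k =>
            (if (i : ℕ) * k + j < q then Ψ r.succ i j else Ψ r.castSucc i j).1).card < T.card).card
      = ((univ : Finset (Fin m → Fin k → Fin n × Bool)).filter fun Φ => ∃ T : Finset (Fin m),
          (T.biUnion fun i => univ.image fun j : Fin k => (Φ i j).1).card < T.card).card *
        Fintype.card (Fin m → Fin k → Fin n × Bool) ^ k :=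
    (hc_card_filter_splice k m n r q (fun Φ => ∃ T : Finset (Fin m),
          (T.biUnion fun i => univ.image fun j : Fin k => (Φ i j).1).card < T.card)).trans
      (by rw [hc_card_filter_apply r.castSucc (fun Φ : Fin m → Fin k → Fin n × Bool =>
            ∃ T : Finset (Fin m),
              (T.biUnion fun i => univ.image fun j : Fin k => (Φ i j).1).card < T.card),
            Fintype.card_fin, Nat.add_sub_cancel])
  have h2 := hc_card_bad_le k m n hk hmn
  have hI : ((Fintype.card (Fin m → Fin k → Fin n × Bool) : ℕ) : ℝ) = (((n : ℝ) * 2) ^ k) ^ m := by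
    simp only [Fintype.card_fun, Fintype.card_prod, Fintype.card_fin, Fintype.card_bool]
    push_cast
    ring
  have hP : ((Fintype.card (Fin (k + 1) → Fin m → Fin k → Fin n × Bool) : ℕ) : ℝ)
      = ((((n : ℝ) * 2) ^ k) ^ m) ^ (k + 1) := by
    simp only [Fintype.card_fun, Fintype.card_prod, Fintype.card_fin, Fintype.card_bool]
    push_cast
    ring
  rw [h1, hP, Nat.cast_mul, Nat.cast_pow, hI]
  have hn0 : (n : ℝ) ≠ 0 := by exact_mod_cast (by omega : n ≠ 0)
  calc _ ≤ ((∑ c ∈ Icc 2 m, m.choose c * n.choose (c - 1) *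
          ((2 * (c - 1)) ^ (k * c) * (2 * n) ^ (k * (m - c))) : ℕ) : ℝ) *
            ((((n : ℝ) * 2) ^ k) ^ m) ^ k :=
        mul_le_mul_of_nonneg_right (by exact_mod_cast h2) (by positivity)
    _ = _ := by
        rw [Nat.cast_sum, Finset.sum_mul, Finset.mul_sum]
        refine Finset.sum_congr rfl fun c hc => ?_
        obtain ⟨d, rfl⟩ := Nat.exists_eq_add_of_le (Finset.mem_Icc.mp hc).2
        rw [Nat.add_sub_cancel_left, div_pow]
        simp only [mul_div_assoc']
        rw [eq_div_iff (pow_ne_zero _ hn0)]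
        push_cast
        ring

end Summit.PneNP.PneNP.Cruxes.SolvableImpliesStableSection.Sketch
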